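import Literature.NumberTheory.EllipticCurves.Fisher2012.HessePencilThreeClosedForms
import Literature.NumberTheory.EllipticCurves.Fisher2012.HessePencilThreeIdentities
import Literature.NumberTheory.EllipticCurves.Fisher2012.ThreeTorsionFracLinearTransfer
import HarnessLib

/-!
# DISCHARGE of `Fisher2012.thm132_threeCongruent_hessePencil` — Fisher, Proc. LMS 104 (2012)
# Thm. 13.2, direction "if", `n = 3`, `K = ℚ`: every non-singular member `E_{λ,μ}` of the Hesse pencil
# of `E : y² = x³ − 27c₄x − 54c₆` has `E_{λ,μ}[3] ≅ E[3]` as `Γ_ℚ`-modules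
# (cell `b2b-bsdres`, team n1011, seat p02 gen 7 — 'T-F132-3'; the named fact was registered by the
# class-closure lane in `HesseFamilyFiveCongruence.lean` and is consumed by
# `threeCongruent_of_hesseCertificate`; this file proves it, so those consumers can drop `hF`)

HONEST FRAMING (cell `b2b-bsdres`, run/shared/lean/b2b/bsd-rank1-residual/, verbatim in every
file): the goal of the cell is to DELETE the COMBINATION-SHAPED residual classes of the
Birch–Swinnerton-Dyer formula for ALL analytic-rank `≤ 1` elliptic curves over `ℚ` — "full BSD
formula for every rank `≤ 1` curve in class `C`" assembled STRICTLY from published theorems — so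
that the rank-`≤ 1` remainder becomes exactly the CONSTRUCTION-SHAPED classes, which are TYPED
(missing-input `Prop`s), NOT attempted. This is not "finishing BSD". This file: our formalisation of
a published theorem (NET named-fact debt −1); no definition, no new named fact; no label changes.

## Proof (classical syzygetic pencil; files F1–F3 of this seat)

`E_{λ,μ}` is the Weierstrass model of the plane cubic `λ·C − (μ/9)·He(C)/8` (`C` the cubic of `E`,
`He` its Hessian), which passes through the nine flexes `E[3]` of `C`; the projective-linear
normalising map is `(x, y) ↦ ((ax + b)/(3λ − μx), 3𝔇y/(3λ − μx))`, `a = 3(λ³ − 3c₄λμ² − 2c₆μ³)`,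
`b = −27μ(c₄λ² + 2c₆λμ + c₄²μ²)`, `𝔇 = 𝔇(λ,μ)` (`HessePencilThreeIdentities`: it sends `3`-division
abscissae to `3`-division abscissae and `3`-torsion points onto the curve — two quartic identities —
with non-vanishing denominator and determinant `9𝔇 ≠ 0` exactly when `E_{λ,μ}` is non-singular,
tree `isElliptic_hessePencil3_iff`).  A fractional-linear datum of this shape yields a
`Γ_ℚ`-equivariant additive bijection `E[3] ≃ E_{λ,μ}[3]` (`threeCongruent_of_fracLinearDatum`:
collinearity is preserved, and three points of a Weierstrass cubic are collinear iff they sum to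
`O`); its inverse is the isomorphism of the statement.

References: [Fisher2012Hessian] T. Fisher, The Hessian of a genus one curve, Proc. LMS (3) 104 (2012)
613–648, §8, Def. 13.1, Thm. 13.2; [SilvermanAEC2009] III.2.3, Cor. III.6.4, Ex. 3.7.
-/

noncomputable section

open scoped Classical

open WeierstrassCurve Literature.NumberTheory.EllipticCurves

namespace Literature.NumberTheory.EllipticCurves.Fisher2012

/-- The inverse of an equivariant additive isomorphism is equivariant. [folklore] -/
private theorem addEquiv_symm_smul_comm {G A B : Type*} [SMul G A] [SMul G B] [AddCommGroup A]
    [AddCommGroup B] (f : A ≃+ B) (hf : ∀ (σ : G) (P : A), f (σ • P) = σ • f P) (σ : G) (Q : B) :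
    f.symm (σ • Q) = σ • f.symm Q := by
  apply f.injective
  rw [f.apply_symm_apply, hf, f.apply_symm_apply]

/-- **Fisher 2012, Theorem 13.2 (`n = 3`, direction "if", `K = ℚ`) — PROVED**: for every elliptic
curve `E : y² = x³ − 27c₄x − 54c₆` over `ℚ` and every non-singular member `E_{λ,μ}` (`λ, μ ∈ ℚ`) of its
`n = 3` Hesse pencil there is a `Γ_ℚ`-equivariant isomorphism `E_{λ,μ}[3] ≅ E[3]`.  Discharges the
named fact `thm132_threeCongruent_hessePencil` of `HesseFamilyFiveCongruence.lean`.
[cite: Fisher2012Hessian, Thm. 13.2 (n = 3, with §8 and Def. 13.1)] -/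
theorem thm132_threeCongruent_hessePencil_holds : thm132_threeCongruent_hessePencil := by
  intro c₄ c₆ l m hE hE'
  -- pin the `ℚ`-algebra structure of `ℚ̄` to the one the generic transfer theorem carries
  letI : Algebra ℚ (AlgebraicClosure ℚ) := AlgebraicClosure.instAlgebra ℚ
  -- `𝔇(λ,μ) ≠ 0` (non-singular member)
  have hD : (l ^ 4 - 6 * c₄ * l ^ 2 * m ^ 2 - 8 * c₆ * l * m ^ 3 - 3 * c₄ ^ 2 * m ^ 4) ≠ 0 := by
    have h := (isElliptic_hessePencil3_iff c₄ c₆ l m).mp hE'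
    rwa [eval_hesseD3] at h
  -- the two curves over `ℚ̄`
  have hW : (c4c6Model c₄ c₆).baseChange (AlgebraicClosure ℚ) =
      ⟨0, 0, 0, -27 * algebraMap ℚ (AlgebraicClosure ℚ) c₄,
        -54 * algebraMap ℚ (AlgebraicClosure ℚ) c₆⟩ := by
    simp only [c4c6Model, WeierstrassCurve.baseChange, WeierstrassCurve.map]
    ext <;> simp
  have hW' : (hessePencil3 c₄ c₆ l m).baseChange (AlgebraicClosure ℚ) =
      ⟨0, 0, 0,
        -27 * (algebraMap ℚ (AlgebraicClosure ℚ) c₄ * algebraMap ℚ (AlgebraicClosure ℚ) l ^ 4 + 4 * algebraMap ℚ (AlgebraicClosure ℚ) c₆ * algebraMap ℚ (AlgebraicClosure ℚ) l ^ 3 * algebraMap ℚ (AlgebraicClosure ℚ) m + 6 * algebraMap ℚ (AlgebraicClosure ℚ) c₄ ^ 2 * algebraMap ℚ (AlgebraicClosure ℚ) l ^ 2 * algebraMap ℚ (AlgebraicClosure ℚ) m ^ 2 + 4 * algebraMap ℚ (AlgebraicClosure ℚ) c₄ * algebraMap ℚ (AlgebraicClosure ℚ) c₆ * algebraMap ℚ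 (AlgebraicClosure ℚ) l * algebraMap ℚ (AlgebraicClosure ℚ) m ^ 3 +
    (4 * algebraMap ℚ (AlgebraicClosure ℚ) c₆ ^ 2 - 3 * algebraMap ℚ (AlgebraicClosure ℚ) c₄ ^ 3) * algebraMap ℚ (AlgebraicClosure ℚ) m ^ 4),
        -54 * (algebraMap ℚ (AlgebraicClosure ℚ) c₆ * algebraMap ℚ (AlgebraicClosure ℚ) l ^ 6 + 6 * algebraMap ℚ (AlgebraicClosure ℚ) c₄ ^ 2 * algebraMap ℚ (AlgebraicClosure ℚ) l ^ 5 * algebraMap ℚ (AlgebraicClosure ℚ) m + 15 * algebraMap ℚ (AlgebraicClosure ℚ) c₄ * algebraMap ℚ (AlgebraicClosure ℚ) c₆ * algebraMap ℚ (AlgebraicClosure ℚ) l ^ 4 * algebraMap ℚ (AlgebraicClosure ℚ) m ^ 2 + 20 * algebraMap ℚ (AlgebraicClosure ℚ) c₆ ^ 2 * algebraMap ℚ (AlgebraicClosure ℚ) l ^ 3 * algebraMap ℚ (AlgebraicClosure ℚ) m ^ 3 +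
    15 * algebraMap ℚ (AlgebraicClosure ℚ) c₄ ^ 2 * algebraMap ℚ (AlgebraicClosure ℚ) c₆ * algebraMap ℚ (AlgebraicClosure ℚ) l ^ 2 * algebraMap ℚ (AlgebraicClosure ℚ) m ^ 4 + (18 * algebraMap ℚ (AlgebraicClosure ℚ) c₄ ^ 4 - 12 * algebraMap ℚ (AlgebraicClosure ℚ) c₄ * algebraMap ℚ (AlgebraicClosure ℚ) c₆ ^ 2) * algebraMap ℚ (AlgebraicClosure ℚ) l * algebraMap ℚ (AlgebraicClosure ℚ) m ^ 5 +
    (9 * algebraMap ℚ (AlgebraicClosure ℚ) c₄ ^ 3 * algebraMap ℚ (AlgebraicClosure ℚ) c₆ - 8 * algebraMap ℚ (AlgebraicClosure ℚ) c₆ ^ 3) * algebraMap ℚ (AlgebraicClosure ℚ) m ^ 6)⟩ := by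
    rw [hessePencil3_eq]
    simp only [WeierstrassCurve.baseChange, WeierstrassCurve.map]
    ext <;> simp
  have hDb : (algebraMap ℚ (AlgebraicClosure ℚ) l ^ 4 - 6 * algebraMap ℚ (AlgebraicClosure ℚ) c₄ * algebraMap ℚ (AlgebraicClosure ℚ) l ^ 2 * algebraMap ℚ (AlgebraicClosure ℚ) m ^ 2 - 8 * algebraMap ℚ (AlgebraicClosure ℚ) c₆ * algebraMap ℚ (AlgebraicClosure ℚ) l * algebraMap ℚ (AlgebraicClosure ℚ) m ^ 3 - 3 * algebraMap ℚ (AlgebraicClosure ℚ) c₄ ^ 2 * algebraMap ℚ (AlgebraicClosure ℚ) m ^ 4) ≠ 0 := by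
    have e : (algebraMap ℚ (AlgebraicClosure ℚ) l ^ 4 - 6 * algebraMap ℚ (AlgebraicClosure ℚ) c₄ * algebraMap ℚ (AlgebraicClosure ℚ) l ^ 2 * algebraMap ℚ (AlgebraicClosure ℚ) m ^ 2 - 8 * algebraMap ℚ (AlgebraicClosure ℚ) c₆ * algebraMap ℚ (AlgebraicClosure ℚ) l * algebraMap ℚ (AlgebraicClosure ℚ) m ^ 3 - 3 * algebraMap ℚ (AlgebraicClosure ℚ) c₄ ^ 2 * algebraMap ℚ (AlgebraicClosure ℚ) m ^ 4) =
        algebraMap ℚ (AlgebraicClosure ℚ) ((l ^ 4 - 6 * c₄ * l ^ 2 * m ^ 2 - 8 * c₆ * l * m ^ 3 - 3 * c₄ ^ 2 * m ^ 4)) := by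
      simp only [map_sub, map_mul, map_pow, map_ofNat]
    rw [e]
    exact (map_ne_zero _).mpr hD
  -- the datum `(a, b, c, d, e)` over `ℚ`
  have ha : algebraMap ℚ (AlgebraicClosure ℚ) (3 * (l ^ 3 - 3 * c₄ * l * m ^ 2 - 2 * c₆ * m ^ 3)) =
      3 * ((algebraMap ℚ (AlgebraicClosure ℚ) l) ^ 3
        - 3 * algebraMap ℚ (AlgebraicClosure ℚ) c₄ * algebraMap ℚ (AlgebraicClosure ℚ) l *
          (algebraMap ℚ (AlgebraicClosure ℚ) m) ^ 2
        - 2 * algebraMap ℚ (AlgebraicClosure ℚ) c₆ * (algebraMap ℚ (AlgebraicClosure ℚ) m) ^ 3) := by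
    simp only [map_sub, map_mul, map_pow, map_ofNat]
  have hb : algebraMap ℚ (AlgebraicClosure ℚ) (-27 * m * (c₄ * l ^ 2 + 2 * c₆ * l * m + c₄ ^ 2 * m ^ 2)) =
      -27 * algebraMap ℚ (AlgebraicClosure ℚ) m *
        (algebraMap ℚ (AlgebraicClosure ℚ) c₄ * (algebraMap ℚ (AlgebraicClosure ℚ) l) ^ 2
          + 2 * algebraMap ℚ (AlgebraicClosure ℚ) c₆ * algebraMap ℚ (AlgebraicClosure ℚ) l *
            algebraMap ℚ (AlgebraicClosure ℚ) m
          + (algebraMap ℚ (AlgebraicClosure ℚ) c₄) ^ 2 * (algebraMap ℚ (AlgebraicClosure ℚ) m) ^ 2) := by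
    simp only [map_add, map_mul, map_pow, map_neg, map_ofNat]
  have hc : algebraMap ℚ (AlgebraicClosure ℚ) (3 * (l ^ 4 - 6 * c₄ * l ^ 2 * m ^ 2 - 8 * c₆ * l * m ^ 3 - 3 * c₄ ^ 2 * m ^ 4)) =
      3 * (algebraMap ℚ (AlgebraicClosure ℚ) l ^ 4 - 6 * algebraMap ℚ (AlgebraicClosure ℚ) c₄ * algebraMap ℚ (AlgebraicClosure ℚ) l ^ 2 * algebraMap ℚ (AlgebraicClosure ℚ) m ^ 2 - 8 * algebraMap ℚ (AlgebraicClosure ℚ) c₆ * algebraMap ℚ (AlgebraicClosure ℚ) l * algebraMap ℚ (AlgebraicClosure ℚ) m ^ 3 - 3 * algebraMap ℚ (AlgebraicClosure ℚ) c₄ ^ 2 * algebraMap ℚ (AlgebraicClosure ℚ) m ^ 4) := by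
    simp only [map_sub, map_mul, map_pow, map_ofNat]
  have hd : algebraMap ℚ (AlgebraicClosure ℚ) (-m) = -algebraMap ℚ (AlgebraicClosure ℚ) m :=
    map_neg _ _
  have he : algebraMap ℚ (AlgebraicClosure ℚ) (3 * l) = 3 * algebraMap ℚ (AlgebraicClosure ℚ) l := by
    simp only [map_mul, map_ofNat]
  obtain ⟨f, hf⟩ := threeCongruent_of_fracLinearDatum (K := ℚ) (c4c6Model c₄ c₆)
    (hessePencil3 c₄ c₆ l m) rfl rfl rfl rfl
    (3 * (l ^ 3 - 3 * c₄ * l * m ^ 2 - 2 * c₆ * m ^ 3))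
    (-27 * m * (c₄ * l ^ 2 + 2 * c₆ * l * m + c₄ ^ 2 * m ^ 2)) (3 * (l ^ 4 - 6 * c₄ * l ^ 2 * m ^ 2 - 8 * c₆ * l * m ^ 3 - 3 * c₄ ^ 2 * m ^ 4)) (-m) (3 * l)
    (by rw [hesse3_det]; exact mul_ne_zero (by norm_num) hD)
    (mul_ne_zero three_ne_zero hD)
    (by
      intro x hx
      rw [hW] at hx
      rw [hd, he]
      exact hesse3_den_ne_zero _ _ _ _ hDb hx)
    (by
      intro x hx
      rw [hW] at hx
      rw [hW']
      exact hesse3_eval_Ψ₃_eq_zero _ _ _ _ _ _ _ _ ha hb hd he hDb hx)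
    (by
      intro x y hxy hx
      rw [hW] at hx hxy
      rw [hW']
      exact hesse3_equation _ _ _ _ _ _ _ _ _ ha hb hc hd he hDb hxy hx)
  exact ⟨f.symm, addEquiv_symm_smul_comm f hf⟩

/-- **Unconditional `3`-torsion transport along the Hesse pencil, any model.** For every elliptic
curve `W/ℚ` and every non-singular member of the `n = 3` Hesse pencil of its `c₄,c₆`-model,
`E_{λ,μ}[3] ≅ W[3]` as `Γ_ℚ`-modules — the tree's `threeCongruent_hessePencil3` with its `hF`
discharged. [cite: Fisher2012Hessian, Thm. 13.2 (n = 3)] -/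
theorem threeCongruent_hessePencil3_unconditional (W : WeierstrassCurve ℚ) [W.IsElliptic] (l m : ℚ)
    [(hessePencil3 W.c₄ W.c₆ l m).IsElliptic] :
    ∃ e : geomTorsion (hessePencil3 W.c₄ W.c₆ l m) (3 : ℤ) ≃+ geomTorsion W (3 : ℤ),
      ∀ (σ : Field.absoluteGaloisGroup ℚ) (Q : geomTorsion (hessePencil3 W.c₄ W.c₆ l m) (3 : ℤ)),
        e (σ • Q) = σ • e Q :=
  threeCongruent_hessePencil3 thm132_threeCongruent_hessePencil_holds W l m

/-- **Unconditional Hesse certificate, direct kind.** `W, G` elliptic curves over `ℚ`, `l m u : ℚ`,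
`u ≠ 0`, with `𝔠₄(l,m) = u⁴·c₄(G)` and `𝔠₆(l,m) = u⁶·c₆(G)` ⟹ `G[3] ≅ W[3]` as `Γ_ℚ`-modules —
the tree's `threeCongruent_of_hesseCertificate` with its named-fact hypothesis `hF` DISCHARGED by
`thm132_threeCongruent_hessePencil_holds` (every DIRECT `X3E` Hesse certificate of the cell is now an
unconditional kernel statement). [cite: Fisher2012Hessian, Thm. 13.2 (n = 3)] -/
theorem threeCongruent_of_hesseCertificate_unconditional (W G : WeierstrassCurve ℚ) [W.IsElliptic]
    [G.IsElliptic] (l m u : ℚ) (hu : u ≠ 0)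
    (h4 : MvPolynomial.eval ![l, m] (hesseC4three W.c₄ W.c₆) = u ^ 4 * G.c₄)
    (h6 : MvPolynomial.eval ![l, m] (hesseC6three W.c₄ W.c₆) = u ^ 6 * G.c₆) :
    ∃ e : geomTorsion G (3 : ℤ) ≃+ geomTorsion W (3 : ℤ),
      ∀ (σ : Field.absoluteGaloisGroup ℚ) (Q : geomTorsion G (3 : ℤ)), e (σ • Q) = σ • e Q :=
  threeCongruent_of_hesseCertificate thm132_threeCongruent_hessePencil_holds W G l m u hu h4 h6

end Literature.NumberTheory.EllipticCurves.Fisher2012
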